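import Summits.CriticalPhenomena.PercolationContinuityZ3.Theorems.PercNearOneGluingNoHeavyLowerTailTerminalEdgeStepOfL1
import Summits.CriticalPhenomena.PercolationContinuityZ3.Theorems.PercNearOneGluingNoHeavyLowerTailFourPointAtomsStep
import Summits.CriticalPhenomena.PercolationContinuityZ3.Theorems.PercNearOneGluingNoHeavyLowerTailCubicFourPointL1LeFive
import Summits.CriticalPhenomena.PercolationContinuityZ3.Theorems.PercNearOneGluingNoHeavyLowerTailBernsteinPieces
import HarnessLib

/-!
# `NoHeavyLowerTail` (crux stmt-CriticalPhenomena-4575): the terminal-edge step for EVERY number of vertices from (L1) —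
# `PolarisedRowL1 → ∀ N₀, BernsteinStepUpTo N₀ ∧ PolarisedStepUpTo N₀`, `PolarisedRowL1 → BernsteinPieceB1 ∧ BernsteinPieceB2`,
# and the bridge `L1Conj ⇒ PolarisedRowL1`

Support file (prover seat `prim-bnk-1`, bounded-n kernel lane, gen 3; `--supports stmt-CriticalPhenomena-4575`).  No definitions, no named
facts, no sorries, no `native_decide`.

The bounded-`n` kernel theorems of this lane (`TerminalEdgeStep.bernsteinStepUpTo_five`, `polarisedStepUpTo_five`, prim-bnk-1 gen 1;
`CombStep 6/7` certified off-line by two implementations, prim-bnk-1/2) prove the SHK3⁺ terminal-edge step on `≤ 5` vertices by three-copy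
comb certificates.  Here the rung `N₀ = ∞` is reached CONDITIONALLY on the single named open row (L1) = `PolarisedRowL1`
(`…GroupSepHybridRows`), using the measure-level assembly `…TerminalEdgeStepOfL1`:
* `stepArgs_cell` — the ten arguments `(q,u₁,u₂,u₃,t,α₁,α₂,β₁,β₂,β₃)` of `BernsteinStepUpTo` as four-point cell sums;
* `bernsteinStepUpTo_of_polarisedRowL1 : PolarisedRowL1 → ∀ N₀, BernsteinStepUpTo N₀`;
* `cval_qTerms_zero_eq_polL₁`, `cval_qTerms_one_eq_polL₂` — rows `0, 1` of `…TerminalEdgeStepLeFive` are `polL₁`, `polL₂` of the cells;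
  `polarisedStepUpTo_of_polarisedRowL1 : PolarisedRowL1 → ∀ N₀, PolarisedStepUpTo N₀`;
* `polL₁_cell_eq_l1W` — `polL₁(cells) = CubicFourPointL1.l1W univ w ∅ a b c y` (prim-l12-p2's functional), hence
  `polarisedRowL1_of_l1Conj : (∀ V, L1Conj V) → PolarisedRowL1` and `l1W_univ_nonneg_of_polarisedRowL1`;
* `real_bc5 … real_bc9` + `bernsteinPieces_of_polarisedRowL1 : PolarisedRowL1 → BernsteinPieceB1 ∧ BernsteinPieceB2` — the P1 line's named
  measure-level statements of (B1), (B2) (`…BernsteinPieces`, prim-l12-p1; there attacked directly by oracle-LP switching certificates).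
With `…TerminalEdgeStepOfL1` this makes the kernel replay of the (L1) certificate (prim-l12-p2, `0 ≤ l1W` for every system) the ONLY missing
piece for (L2), (B1), (B2) and both bounded-`n` statements at every `N₀`.
-/

noncomputable section

namespace Summit.CriticalPhenomena.PercolationContinuityZ3.Theorems

open MeasureTheory Set Literature.Probability.Percolation
open Literature.Probability.LatticeModels (prodBernoulli)

namespace FourPointAtoms

open Summit.CriticalPhenomena.PercolationContinuityZ3.Cruxes.AdditiveGluing.TieLine.ConnAtoms

variable {V : Type*} [Fintype V] (w : Sym2 V → unitInterval) (a b c y : V)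

/-! ### Dictionary entries for the event shapes of `bernsteinCells` (P1 line, `…BernsteinPieces`) -/

/-- `μ(openConn b y ∩ (openConn a b)ᶜ ∩ (openConn a c)ᶜ ∩ (openConn b c)ᶜ)` (`bernsteinCells` 5) as a sum of four-point cells. [this work] -/
theorem real_bc5 : (prodBernoulli w).real (openConn b y ∩ (openConn a b)ᶜ ∩ (openConn a c)ᶜ ∩ (openConn b c)ᶜ) =
    cell w a b c y 2 := by
  rw [measureReal_eq_cellSum w a b c y (show HasPattern (quad a b c y) (openConn b y ∩ (openConn a b)ᶜ ∩ (openConn a c)ᶜ ∩ (openConn b c)ᶜ) _ from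
    ((((oc a b c y 1 3 rfl rfl).inter (oc a b c y 0 1 rfl rfl).compl).inter (oc a b c y 0 2 rfl rfl).compl).inter (oc a b c y 1 2 rfl rfl).compl))]
  simp (config := {decide := true}) only [ite_true, ite_false]; ring

/-- `μ(openConn c y ∩ (openConn a b)ᶜ ∩ (openConn a c)ᶜ ∩ (openConn b c)ᶜ)` (`bernsteinCells` 6) as a sum of four-point cells. [this work] -/
theorem real_bc6 : (prodBernoulli w).real (openConn c y ∩ (openConn a b)ᶜ ∩ (openConn a c)ᶜ ∩ (openConn b c)ᶜ) =
    cell w a b c y 1 := by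
  rw [measureReal_eq_cellSum w a b c y (show HasPattern (quad a b c y) (openConn c y ∩ (openConn a b)ᶜ ∩ (openConn a c)ᶜ ∩ (openConn b c)ᶜ) _ from
    ((((oc a b c y 2 3 rfl rfl).inter (oc a b c y 0 1 rfl rfl).compl).inter (oc a b c y 0 2 rfl rfl).compl).inter (oc a b c y 1 2 rfl rfl).compl))]
  simp (config := {decide := true}) only [ite_true, ite_false]; ring

/-- `μ(openConn a b ∩ openConn c y ∩ (openConn a c)ᶜ)` (`bernsteinCells` 7) as a sum of four-point cells. [this work] -/
theorem real_bc7 : (prodBernoulli w).real (openConn a b ∩ openConn c y ∩ (openConn a c)ᶜ) =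
    cell w a b c y 11 := by
  rw [measureReal_eq_cellSum w a b c y (show HasPattern (quad a b c y) (openConn a b ∩ openConn c y ∩ (openConn a c)ᶜ) _ from
    (((oc a b c y 0 1 rfl rfl).inter (oc a b c y 2 3 rfl rfl)).inter (oc a b c y 0 2 rfl rfl).compl))]
  simp (config := {decide := true}) only [ite_true, ite_false]; ring

/-- `μ(openConn a c ∩ openConn b y ∩ (openConn a b)ᶜ)` (`bernsteinCells` 8) as a sum of four-point cells. [this work] -/
theorem real_bc8 : (prodBernoulli w).real (openConn a c ∩ openConn b y ∩ (openConn a b)ᶜ) =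
    cell w a b c y 9 := by
  rw [measureReal_eq_cellSum w a b c y (show HasPattern (quad a b c y) (openConn a c ∩ openConn b y ∩ (openConn a b)ᶜ) _ from
    (((oc a b c y 0 2 rfl rfl).inter (oc a b c y 1 3 rfl rfl)).inter (oc a b c y 0 1 rfl rfl).compl))]
  simp (config := {decide := true}) only [ite_true, ite_false]; ring

/-- `μ(openConn b c ∩ openConn b y ∩ (openConn a b)ᶜ)` (`bernsteinCells` 9) as a sum of four-point cells. [this work] -/
theorem real_bc9 : (prodBernoulli w).real (openConn b c ∩ openConn b y ∩ (openConn a b)ᶜ) =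
    cell w a b c y 7 := by
  rw [measureReal_eq_cellSum w a b c y (show HasPattern (quad a b c y) (openConn b c ∩ openConn b y ∩ (openConn a b)ᶜ) _ from
    (((oc a b c y 1 2 rfl rfl).inter (oc a b c y 1 3 rfl rfl)).inter (oc a b c y 0 1 rfl rfl).compl))]
  simp (config := {decide := true}) only [ite_true, ite_false]; ring

end FourPointAtoms

namespace TerminalEdgeStep

open FourPointAtoms CubicFourPoint CubicThreePointStep E3GroupSepCert
open Literature.Probability.LatticeModels (prodBernoulli sahiE3 sahiE3_def)

/-! ### The bounded-`n` statements for EVERY `N₀`, from (L1) -/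

variable {n : ℕ}

/-- The ten arguments of `threeB₁/threeB₂` in `BernsteinStepUpTo` (three-point law of `(a,b,c)` and the apex transition masses) as
cell sums. [this work] -/
theorem stepArgs_cell (w : Sym2 (Fin n) → unitInterval) (a b c y : Fin n) :
    lq w a b c = cell w a b c y 0 + cell w a b c y 1 + cell w a b c y 2 + cell w a b c y 4 ∧
    lu₁ w a b c = cell w a b c y 6 + cell w a b c y 11 + cell w a b c y 12 ∧
    lu₂ w a b c = cell w a b c y 5 + cell w a b c y 9 + cell w a b c y 10 ∧
    lu₃ w a b c = cell w a b c y 3 + cell w a b c y 7 + cell w a b c y 8 ∧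
    lt w a b c = cell w a b c y 13 + cell w a b c y 14 ∧
    lα₁ w a b c y = cell w a b c y 2 ∧ lα₂ w a b c y = cell w a b c y 1 ∧
    lβ₁ w a b c y = cell w a b c y 11 ∧ lβ₂ w a b c y = cell w a b c y 9 ∧ lβ₃ w a b c y = cell w a b c y 7 := by
  simp only [lq, lu₁, lu₂, lu₃, lt, lα₁, lα₂, lβ₁, lβ₂, lβ₃, connEvent_pQ, connEvent_pU₁, connEvent_pU₂, connEvent_pU₃,
    connEvent_pT, connEvent_pA₁, connEvent_pA₂, connEvent_pB₁, connEvent_pB₂, connEvent_pB₃]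
  rw [real_shk_ABC, real_lu1, real_lu2, real_lu3, real_lt, real_la1, real_la2, real_lb1, real_lb2, real_lb3]
  exact ⟨rfl, rfl, rfl, rfl, rfl, rfl, rfl, rfl, rfl, rfl⟩

/-- **(L1) ⇒ the Bernstein terminal-edge step for EVERY number of vertices**: `PolarisedRowL1 → ∀ N₀, BernsteinStepUpTo N₀`
(rung `N₀ = ∞` of the bounded-`n` ladder `bernsteinStepUpTo_five`, conditional only on the named open row (L1)). [this work] -/
theorem bernsteinStepUpTo_of_polarisedRowL1 (hL1 : PolarisedRowL1) (N₀ : ℕ) : BernsteinStepUpTo N₀ := by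
  intro n _ w a b c y _ _ _ _ _ _
  obtain ⟨hq, hu₁, hu₂, hu₃, ht, hα₁, hα₂, hβ₁, hβ₂, hβ₃⟩ := stepArgs_cell w a b c y
  rw [hq, hu₁, hu₂, hu₃, ht, hα₁, hα₂, hβ₁, hβ₂, hβ₃]
  exact ⟨threeB₁_cell_nonneg w a b c y hL1, threeB₂_cell_nonneg w a b c y hL1⟩

set_option maxRecDepth 10000 in
set_option maxHeartbeats 1600000 in
/-- Row `0` of `…TerminalEdgeStepLeFive` ((L1) in the `cval` vocabulary) is `polL₁` of the cells. [this work] -/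
theorem cval_qTerms_zero_eq_polL₁ (w : Sym2 (Fin n) → unitInterval) (a b c y : Fin n) :
    cval w (qTerms 0 (a, b, c, y)) =
      polL₁ (cell w a b c y 0) (cell w a b c y 1) (cell w a b c y 2) (cell w a b c y 3) (cell w a b c y 4) (cell w a b c y 5)
        (cell w a b c y 6) (cell w a b c y 7) (cell w a b c y 8) (cell w a b c y 9) (cell w a b c y 10) (cell w a b c y 11)
        (cell w a b c y 12) (cell w a b c y 13) (cell w a b c y 14) := by
  unfold cval qTerms e3Terms
  simp only [List.map_append, List.sum_append, List.map_cons, List.map_nil, List.sum_cons, List.sum_nil, pr_pTrue]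
  unfold pr
  simp only [connEvent_pAnd, connEvent_pD, connEvent_pG, connEvent_pB₃]
  rw [real_r1_ABC, real_hyb1_A, real_hyb1_B, real_grp_A, real_r1_BC, real_r1_AC, real_hyb1_AB, real_r2_ABC, real_grp_B,
    real_hyb2_C, real_r2_BC, real_hyb2_AC, real_r2_AB, real_lb3]
  simp only [polL₁, hybE₁, hybE₂, E3h]
  rw [sum_cell_eq_one w a b c y]
  push_cast
  ring

set_option maxRecDepth 10000 in
set_option maxHeartbeats 1600000 in
/-- Row `1` of `…TerminalEdgeStepLeFive` ((L2) in the `cval` vocabulary) is `polL₂` of the cells. [this work] -/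
theorem cval_qTerms_one_eq_polL₂ (w : Sym2 (Fin n) → unitInterval) (a b c y : Fin n) :
    cval w (qTerms 1 (a, b, c, y)) =
      polL₂ (cell w a b c y 0) (cell w a b c y 1) (cell w a b c y 2) (cell w a b c y 3) (cell w a b c y 4) (cell w a b c y 5)
        (cell w a b c y 6) (cell w a b c y 7) (cell w a b c y 8) (cell w a b c y 9) (cell w a b c y 10) (cell w a b c y 11)
        (cell w a b c y 12) (cell w a b c y 13) (cell w a b c y 14) := by
  unfold cval qTerms e3Terms
  simp only [List.map_append, List.sum_append, List.map_cons, List.map_nil, List.sum_cons, List.sum_nil, pr_pTrue]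
  unfold pr
  simp only [connEvent_pAnd, connEvent_pD, connEvent_pG, connEvent_pB₃, connEvent_pGbc]
  rw [real_r3_ABC, real_hyb1_A, real_grp_B, real_grp_A, real_r3_BC, real_r1_AC, real_r2_AB,
    real_r1_ABC, real_hyb1_B, real_r1_BC, real_hyb1_AB, real_r2_ABC, real_hyb2_C, real_r2_BC, real_hyb2_AC, real_lb3, real_GbcU]
  simp only [polL₂, hybE₃g, hybE₁, hybE₂, E3h]
  rw [sum_cell_eq_one w a b c y]
  push_cast
  ring

/-- **(L1) ⇒ the polarised terminal-edge step for EVERY number of vertices**: `PolarisedRowL1 → ∀ N₀, PolarisedStepUpTo N₀`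
(rung `N₀ = ∞` of `polarisedStepUpTo_five`, conditional only on (L1)). [this work] -/
theorem polarisedStepUpTo_of_polarisedRowL1 (hL1 : PolarisedRowL1) (N₀ : ℕ) : PolarisedStepUpTo N₀ := by
  intro n _ w a b c y _ _ _ _ _ _
  refine ⟨?_, ?_⟩
  · show 0 ≤ cval w (qTerms 0 (a, b, c, y))
    rw [cval_qTerms_zero_eq_polL₁]
    exact polL₁_cell_nonneg w a b c y hL1
  · show 0 ≤ cval w (qTerms 1 (a, b, c, y))
    rw [cval_qTerms_one_eq_polL₂]
    exact polL₂_cell_nonneg w a b c y hL1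

/-! ### Bridge from prim-l12-p2's deletion–contraction vocabulary: `L1Conj` ⇒ (L1) -/

section Bridge

variable {V : Type} [Fintype V] [DecidableEq V] (w : Sym2 V → unitInterval) (a b c y : V)

set_option maxRecDepth 10000 in
set_option maxHeartbeats 1600000 in
/-- `polL₁(cells) = l1W univ w ∅ a b c y` (prim-l12-p2's (L1) functional on the full weighted graph, no forced edges). [this work] -/
theorem polL₁_cell_eq_l1W :
    polL₁ (cell w a b c y 0) (cell w a b c y 1) (cell w a b c y 2) (cell w a b c y 3) (cell w a b c y 4) (cell w a b c y 5)
        (cell w a b c y 6) (cell w a b c y 7) (cell w a b c y 8) (cell w a b c y 9) (cell w a b c y 10) (cell w a b c y 11)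
        (cell w a b c y 12) (cell w a b c y 13) (cell w a b c y 14) =
      CubicFourPointL1.l1W Finset.univ (fun e => (w e : ℝ)) ∅ a b c y := by
  rw [CubicFourPointL1.l1W_univ_eq_sahiE3, sahiE3_def, sahiE3_def, real_g1_ABC, real_hyb1_A, real_hyb1_B, real_grp_A, real_r1_BC,
    real_r1_AC, real_hyb1_AB, real_g2_ABC, real_grp_B, real_hyb2_C, real_r2_BC, real_hyb2_AC, real_r2_AB, real_lb3]
  simp only [polL₁, hybE₁, hybE₂, E3h]
  rw [sum_cell_eq_one w a b c y]
  ring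

end Bridge

/-- **prim-l12-p2's `L1Conj` (all vertex types) implies `PolarisedRowL1`.**  So a proof of `0 ≤ l1W D p K a b c y` for every system — e.g.
the kernel replay of the theorem-rows certificate of (L1) — discharges the hypothesis of every theorem in this file. [this work] -/
theorem polarisedRowL1_of_l1Conj (h : ∀ (V : Type) [Fintype V] [DecidableEq V], CubicFourPointL1.L1Conj V) : PolarisedRowL1 := by
  intro V _ w a b c y
  classical
  have h1 := h V Finset.univ ∅ (fun e => (w e : ℝ)) (fun e => (w e).2.1) (fun e => (w e).2.2) a b c y
  rw [← polL₁_cell_eq_l1W, polL₁_cell_eq] at h1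
  exact sub_nonneg.1 h1

/-- Conversely **`PolarisedRowL1` gives `L1Conj` on the full graph** (`D = univ`, no forced edges) for weights in `[0,1]`. [this work] -/
theorem l1W_univ_nonneg_of_polarisedRowL1 (hL1 : PolarisedRowL1) {V : Type} [Fintype V] [DecidableEq V]
    (w : Sym2 V → unitInterval) (a b c y : V) : 0 ≤ CubicFourPointL1.l1W Finset.univ (fun e => (w e : ℝ)) ∅ a b c y := by
  rw [← polL₁_cell_eq_l1W]
  exact polL₁_cell_nonneg w a b c y hL1


/-! ### (L1) ⇒ the P1 line's measure-level Bernstein statements `BernsteinPieceB1`, `BernsteinPieceB2` -/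

/-- **(L1) ⇒ (B1) ∧ (B2) as the P1 line's named measure-level statements**: `PolarisedRowL1 → BernsteinPieceB1 ∧ BernsteinPieceB2`
(every finite vertex type, every weight vector, all `a b c y`; the ten `bernsteinCells` masses are four-point cell sums). [this work] -/
theorem bernsteinPieces_of_polarisedRowL1 (hL1 : PolarisedRowL1) : BernsteinPieceB1 ∧ BernsteinPieceB2 := by
  refine ⟨fun V _ w a b c y => ?_, fun V _ w a b c y => ?_⟩ <;> intro m <;>
  · have h0 : m 0 = _ := real_shk_ABC w a b c y
    have h1 : m 1 = _ := real_lu1 w a b c y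
    have h2 : m 2 = _ := real_lu2 w a b c y
    have h3 : m 3 = _ := real_lu3 w a b c y
    have h4 : m 4 = _ := real_lt w a b c y
    have h5 : m 5 = _ := real_bc5 w a b c y
    have h6 : m 6 = _ := real_bc6 w a b c y
    have h7 : m 7 = _ := real_bc7 w a b c y
    have h8 : m 8 = _ := real_bc8 w a b c y
    have h9 : m 9 = _ := real_bc9 w a b c y
    rw [h0, h1, h2, h3, h4, h5, h6, h7, h8, h9]
    first | exact threeB₁_cell_nonneg w a b c y hL1 | exact threeB₂_cell_nonneg w a b c y hL1

end TerminalEdgeStep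

end Summit.CriticalPhenomena.PercolationContinuityZ3.Theorems
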